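import Literature.AlgebraicGeometry.Frobenioids.Perfection
import HarnessLib

/-!
# Frobenioids I, Definition 3.1 (iii): the perfection `C^pf` as a category; the functor `C → C^pf`

Mochizuki, *The geometry of Frobenioids I: the general theory*, Kyushu J. Math. **62** (2008)
293–400, Definition 3.1 (iii), p. 57 [cite: MochizukiFrdI2008, Def. 3.1 (iii) p.57]: "composition of
morphisms of `C^pf` is defined in the evident fashion … Also, we obtain a natural functor `C → C^pf` [by
mapping '`A ↦ (A, 1)`']."

Continuing `Perfection.lean`: composition of perfected morphisms (compose representatives in `C` at a
common triple level; independent of all choices by the uniqueness in Prop. 1.10 (i)), identities, the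
category axioms (unit laws at the triple levels `(a, a, b)`, `(a, b, b)`; associativity at a common
quadruple level, where both bracketings become the plain triple composite in `C`), the `Category`
instance on `Perfection hF`, the objects `root A n = (A, n)` and the functor
`toPf : C ⥤ Perfection hF`, `A ↦ (A, 1)`, `φ ↦` the class of the conjugate of `φ` along the chosen
degree-one Frobenius-type arrows `A → A^{(1)}`, `B → B^{(1)}` (isomorphisms).

DISCLOSURE (hypothesis dropped, a proved generalisation).  Print constructs `C^pf` under the STANDING HYPOTHESIS
"Suppose that the Frobenioid `C` is of Frobenius-isotropic type" (Def. 3.1 (iii) p. 56, restated in the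
preamble of Prop. 3.2, p. 58); this chain (`PerfectionFrobPow`, `Perfection`, `PerfectionCategory`,
`PerfectionOps`, `PerfectionProofs`, `PerfectionCoAngular`) works over a bare Frobenioid `hF : IsFrobenioid F`
— the construction and Prop. 3.2 (i)(ii) need nothing more, so the printed instances follow a fortiori; the
hypothesis is used (and assumed) only where print needs it, for the isotropic-type clause of Prop. 3.2 (iii)
(`PerfectionIsotropic.lean`).
-/

namespace Literature.AlgebraicGeometry.Frobenioids

namespace PreFrobenioid

open CategoryTheory Opposite

universe w v v' u u'

variable {D : Type u} [Category.{v} D] {Φ : Dᵒᵖ ⥤ CommMonCat.{w}}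
  {C : Type u'} [Category.{v'} C] {F : C ⥤ ElemFrobenioid Φ}

/-- The transport of an identity is the transition morphism between the two target powers.
[cite: MochizukiFrdI2008, Def. 3.1 (ii) p.56] -/
theorem liftLevel_one (hF : IsFrobenioid F) (A : C) {d a' b' : ℕ+} (ha : d ∣ a') (hb : d ∣ b')
    (hd : degFr F (frobTrans hF A ha) = degFr F (frobTrans hF A hb)) (h : a' ∣ b') :
    liftLevel hF (𝟙 (frobPow hF A d)) ha hb hd = frobTrans hF A h :=
  (liftLevel_unique hF ha hb hd (by rw [frobTrans_trans, Category.id_comp])).symm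

namespace Perfection

variable {hF : IsFrobenioid F} {X Y Z W : Perfection hF}

/-! ### Composition -/

/-- The composite of two representatives, at the canonical triple level.
[cite: MochizukiFrdI2008, Def. 3.1 (iii) p.57] -/
@[reducible] noncomputable def Rep.comp (r : Rep X Y) (s : Rep Y Z) : Rep X Z :=
  ⟨(Level₃.can r s).out, compAt (Level₃.can r s) r s (Level₃.le_can_fst r s) (Level₃.le_can_snd r s)⟩

/-- Transitivity of the order on triple levels. [cite: MochizukiFrdI2008, Def. 3.1 (iii) p.57] -/
theorem Level₃.LE.trans {T T' T'' : Level₃ X Y Z} (h : T.LE T') (h' : T'.LE T'') : T.LE T'' :=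
  ⟨h.1.trans h'.1, h.2.1.trans h'.2.1, h.2.2.trans h'.2.2⟩

/-- The composite computed at ANY dominating triple level represents the composite.
[cite: MochizukiFrdI2008, Def. 3.1 (iii) p.57] -/
theorem mk_compAt (T : Level₃ X Y Z) (r : Rep X Y) (s : Rep Y Z) (hr : r.L.LE T.fst)
    (hs : s.L.LE T.snd) : Hom.mk ⟨T.out, compAt T r s hr hs⟩ = Hom.mk (r.comp s) := by
  apply Hom.mk_eq_mk.mpr
  refine ⟨(T.sup (Level₃.can r s)).out, (Level₃.le_sup_left _ _).out, (Level₃.le_sup_right _ _).out, ?_⟩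
  change Level.lift T.out _ _ (compAt T r s hr hs) =
    Level.lift (Level₃.can r s).out _ _ (compAt (Level₃.can r s) r s _ _)
  rw [lift_compAt (Level₃.le_sup_left _ _), lift_compAt (Level₃.le_sup_right _ _)]

/-- Composition of representatives respects agreement. [cite: MochizukiFrdI2008, Def. 3.1 (iii) p.57] -/
theorem comp_sound {r r' : Rep X Y} {s s' : Rep Y Z} (hr : Agree r r') (hs : Agree s s') :
    Hom.mk (r.comp s) = Hom.mk (r'.comp s') := by
  obtain ⟨M₁, h₁, h₁', e₁⟩ := hr
  obtain ⟨M₂, h₂, h₂', e₂⟩ := hs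
  let W : Level₃ X Y Z :=
    ((Level₃.can r s).sup (Level₃.can r' s')).sup ((Level₃.ofFst M₁).sup (Level₃.ofSnd M₂))
  have hW₁ : (Level₃.can r s).LE W :=
    (Level₃.le_sup_left _ _).trans (Level₃.le_sup_left _ _)
  have hW₂ : (Level₃.can r' s').LE W :=
    (Level₃.le_sup_right _ _).trans (Level₃.le_sup_left _ _)
  have hM₁ : M₁.LE W.fst :=
    (Level₃.le_ofFst (Z := Z) M₁).trans
      (((Level₃.le_sup_left _ _).trans (Level₃.le_sup_right _ _)) :
        ((Level₃.ofFst M₁).LE W)).fst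
  have hM₂ : M₂.LE W.snd :=
    (Level₃.le_ofSnd (X := X) M₂).trans
      (((Level₃.le_sup_right _ _).trans (Level₃.le_sup_right _ _)) :
        ((Level₃.ofSnd M₂).LE W)).snd
  rw [← mk_compAt W r s ((Level₃.le_can_fst r s).trans hW₁.fst) ((Level₃.le_can_snd r s).trans hW₁.snd),
    ← mk_compAt W r' s' ((Level₃.le_can_fst r' s').trans hW₂.fst)
      ((Level₃.le_can_snd r' s').trans hW₂.snd)]
  unfold compAt
  rw [lift_eq_lift_of_le h₁ h₁' e₁ hM₁, lift_eq_lift_of_le h₂ h₂' e₂ hM₂]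

/-- Composition of perfected morphisms. [cite: MochizukiFrdI2008, Def. 3.1 (iii) p.57] -/
noncomputable def Hom.comp (f : Hom X Y) (g : Hom Y Z) : Hom X Z :=
  Quotient.lift₂ (fun r s => Hom.mk (Rep.comp r s)) (fun _ _ _ _ hr hs => comp_sound hr hs) f g

/-- Composition on representatives. [cite: MochizukiFrdI2008, Def. 3.1 (iii) p.57] -/
theorem Hom.mk_comp_mk (r : Rep X Y) (s : Rep Y Z) :
    Hom.comp (Hom.mk r) (Hom.mk s) = Hom.mk (r.comp s) := rfl

/-- The identity representative `(1, 1; id_{A^{(1)}})`. [cite: MochizukiFrdI2008, Def. 3.1 (iii) p.57] -/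
noncomputable def Rep.id (X : Perfection hF) : Rep X X := ⟨⟨1, 1, rfl⟩, 𝟙 _⟩

/-- The identity perfected morphism. [cite: MochizukiFrdI2008, Def. 3.1 (iii) p.57] -/
noncomputable def Hom.id (X : Perfection hF) : Hom X X := Hom.mk (Rep.id X)

/-! ### The category axioms -/

/-- Left unit law. [cite: MochizukiFrdI2008, Def. 3.1 (iii) p.57] -/
theorem Hom.id_comp (r : Rep X Y) : Hom.comp (Hom.id X) (Hom.mk r) = Hom.mk r := by
  let T : Level₃ X X Y := ⟨r.L.a, r.L.a, r.L.b, rfl, r.L.eq⟩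
  rw [Hom.id, Hom.mk_comp_mk, ← mk_compAt T (Rep.id X) r ⟨one_dvd _, one_dvd _⟩ r.L.le_rfl]
  obtain ⟨L, φ⟩ := r
  unfold compAt
  congr 2
  change liftLevel hF (𝟙 _) _ _ _ ≫ Level.lift L L _ φ = φ
  rw [liftLevel_id, Level.lift_rfl, Category.id_comp]

/-- Right unit law. [cite: MochizukiFrdI2008, Def. 3.1 (iii) p.57] -/
theorem Hom.comp_id (r : Rep X Y) : Hom.comp (Hom.mk r) (Hom.id Y) = Hom.mk r := by
  let T : Level₃ X Y Y := ⟨r.L.a, r.L.b, r.L.b, r.L.eq, rfl⟩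
  rw [Hom.id, Hom.mk_comp_mk, ← mk_compAt T r (Rep.id Y) r.L.le_rfl ⟨one_dvd _, one_dvd _⟩]
  obtain ⟨L, φ⟩ := r
  unfold compAt
  congr 2
  change Level.lift L L _ φ ≫ liftLevel hF (𝟙 _) _ _ _ = φ
  rw [liftLevel_id, Level.lift_rfl, Category.comp_id]

/-- Associativity: at a common quadruple level both bracketings are the plain triple composite in `C`.
[cite: MochizukiFrdI2008, Def. 3.1 (iii) p.57] -/
theorem Hom.assoc (r : Rep X Y) (s : Rep Y Z) (t : Rep Z W) :
    Hom.comp (Hom.comp (Hom.mk r) (Hom.mk s)) (Hom.mk t) =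
      Hom.comp (Hom.mk r) (Hom.comp (Hom.mk s) (Hom.mk t)) := by
  -- a common quadruple level `(a, b, c, d)`
  let a : ℕ+ := r.L.a * s.L.a * t.L.a
  let b : ℕ+ := r.L.b * s.L.a * t.L.a
  let c : ℕ+ := s.L.b * r.L.b * t.L.a
  let d : ℕ+ := t.L.b * (s.L.b * r.L.b)
  have eq₁ : X.idx * a = Y.idx * b := by
    change X.idx * (r.L.a * s.L.a * t.L.a) = Y.idx * (r.L.b * s.L.a * t.L.a)
    calc X.idx * (r.L.a * s.L.a * t.L.a) = X.idx * r.L.a * (s.L.a * t.L.a) := by ac_rfl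
      _ = Y.idx * r.L.b * (s.L.a * t.L.a) := by rw [r.L.eq]
      _ = Y.idx * (r.L.b * s.L.a * t.L.a) := by ac_rfl
  have eq₂ : Y.idx * b = Z.idx * c := by
    change Y.idx * (r.L.b * s.L.a * t.L.a) = Z.idx * (s.L.b * r.L.b * t.L.a)
    calc Y.idx * (r.L.b * s.L.a * t.L.a) = Y.idx * s.L.a * (r.L.b * t.L.a) := by ac_rfl
      _ = Z.idx * s.L.b * (r.L.b * t.L.a) := by rw [s.L.eq]
      _ = Z.idx * (s.L.b * r.L.b * t.L.a) := by ac_rfl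
  have eq₃ : Z.idx * c = W.idx * d := by
    change Z.idx * (s.L.b * r.L.b * t.L.a) = W.idx * (t.L.b * (s.L.b * r.L.b))
    calc Z.idx * (s.L.b * r.L.b * t.L.a) = Z.idx * t.L.a * (s.L.b * r.L.b) := by ac_rfl
      _ = W.idx * t.L.b * (s.L.b * r.L.b) := by rw [t.L.eq]
      _ = W.idx * (t.L.b * (s.L.b * r.L.b)) := by ac_rfl
  let T₁ : Level₃ X Y Z := ⟨a, b, c, eq₁, eq₂⟩
  let T₂ : Level₃ X Z W := ⟨a, c, d, eq₁.trans eq₂, eq₃⟩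
  let T₃ : Level₃ Y Z W := ⟨b, c, d, eq₂, eq₃⟩
  let T₄ : Level₃ X Y W := ⟨a, b, d, eq₁, eq₂.trans eq₃⟩
  have hr : r.L.LE T₁.fst :=
    ⟨Dvd.intro (s.L.a * t.L.a) (show r.L.a * (s.L.a * t.L.a) = r.L.a * s.L.a * t.L.a by ac_rfl),
      Dvd.intro (s.L.a * t.L.a) (show r.L.b * (s.L.a * t.L.a) = r.L.b * s.L.a * t.L.a by ac_rfl)⟩
  have hs : s.L.LE T₁.snd :=
    ⟨Dvd.intro (r.L.b * t.L.a) (show s.L.a * (r.L.b * t.L.a) = r.L.b * s.L.a * t.L.a by ac_rfl),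
      Dvd.intro (r.L.b * t.L.a) (show s.L.b * (r.L.b * t.L.a) = s.L.b * r.L.b * t.L.a by ac_rfl)⟩
  have ht : t.L.LE T₃.snd := ⟨dvd_mul_left _ _, dvd_mul_right _ _⟩
  -- left bracketing
  rw [Hom.mk_comp_mk r s, ← mk_compAt T₁ r s hr hs, Hom.mk_comp_mk,
    ← mk_compAt T₂ ⟨T₁.out, compAt T₁ r s hr hs⟩ t (Level.le_rfl _) ht]
  -- right bracketing
  rw [Hom.mk_comp_mk s t, ← mk_compAt T₃ s t hs ht, Hom.mk_comp_mk,
    ← mk_compAt T₄ r ⟨T₃.out, compAt T₃ s t hs ht⟩ hr (Level.le_rfl _)]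
  unfold compAt
  congr 2
  change Level.lift T₁.out T₁.out _ (Level.lift r.L T₁.fst hr r.hom ≫ Level.lift s.L T₁.snd hs s.hom) ≫
      Level.lift t.L T₃.snd ht t.hom =
    Level.lift r.L T₁.fst hr r.hom ≫
      Level.lift T₃.out T₃.out _ (Level.lift s.L T₁.snd hs s.hom ≫ Level.lift t.L T₃.snd ht t.hom)
  rw [Level.lift_rfl, Level.lift_rfl, Category.assoc]

/-- `C^pf` is a category (Def. 3.1 (iii)). [cite: MochizukiFrdI2008, Def. 3.1 (iii) p.57] -/
noncomputable instance instCategory : Category.{v'} (Perfection hF) where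
  Hom X Y := Hom X Y
  id X := Hom.id X
  comp f g := Hom.comp f g
  id_comp f := by
    obtain ⟨r, rfl⟩ := Hom.mk_surjective f
    exact Hom.id_comp r
  comp_id f := by
    obtain ⟨r, rfl⟩ := Hom.mk_surjective f
    exact Hom.comp_id r
  assoc f g h := by
    obtain ⟨r, rfl⟩ := Hom.mk_surjective f
    obtain ⟨s, rfl⟩ := Hom.mk_surjective g
    obtain ⟨t, rfl⟩ := Hom.mk_surjective h
    exact Hom.assoc r s t

/-- Composition in `C^pf` on representatives. [cite: MochizukiFrdI2008, Def. 3.1 (iii) p.57] -/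
theorem mk_comp_mk (r : Rep X Y) (s : Rep Y Z) :
    (Hom.mk r ≫ Hom.mk s : X ⟶ Z) = Hom.mk (r.comp s) := rfl

/-- The identity of `C^pf` on representatives. [cite: MochizukiFrdI2008, Def. 3.1 (iii) p.57] -/
theorem id_eq_mk (X : Perfection hF) : (𝟙 X : X ⟶ X) = Hom.mk (Rep.id X) := rfl

/-! ### The objects `(A, n)` and the functor `C → C^pf` -/

variable (hF) in
/-- `root A n = (A, n)`, "an '`n`-th root' of `A`". [cite: MochizukiFrdI2008, Def. 3.1 (iii) p.57] -/
abbrev root (A : C) (n : ℕ+) : Perfection hF := ⟨A, n⟩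

/-- Every object of `C^pf` is some `(A, n)`. [cite: MochizukiFrdI2008, Def. 3.1 (iii) p.57] -/
theorem root_surjective (X : Perfection hF) : ∃ (A : C) (n : ℕ+), root hF A n = X := ⟨X.obj, X.idx, rfl⟩

/-- The conjugate of an identity along one Frobenius-type arrow is the identity.
[cite: MochizukiFrdI2008, Prop. 1.10 (i) p.34] -/
theorem conjFr_id {A A' : C} {α : A ⟶ A'} (hα : IsFrobeniusType F α) (hd : degFr F α = degFr F α) :
    conjFr hF (𝟙 A) hα hα hd = 𝟙 A' :=
  (conjFr_unique hF hα hα hd (by rw [Category.id_comp, Category.comp_id])).symm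

/-- The conjugate of a composite is the composite of the conjugates.
[cite: MochizukiFrdI2008, Prop. 1.10 (i) p.34] -/
theorem conjFr_comp {A B E A' B' E' : C} (φ : A ⟶ B) (ψ : B ⟶ E) {α : A ⟶ A'} {β : B ⟶ B'}
    {γ : E ⟶ E'} (hα : IsFrobeniusType F α) (hβ : IsFrobeniusType F β) (hγ : IsFrobeniusType F γ)
    (hd₁ : degFr F α = degFr F β) (hd₂ : degFr F β = degFr F γ) :
    conjFr hF (φ ≫ ψ) hα hγ (hd₁.trans hd₂) = conjFr hF φ hα hβ hd₁ ≫ conjFr hF ψ hβ hγ hd₂ :=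
  (conjFr_unique hF hα hγ _ (by rw [← Category.assoc, conjFr_spec, Category.assoc, conjFr_spec,
    Category.assoc])).symm

variable (hF) in
/-- The image in `C^pf` of an arrow `φ : A → B` of `C`: the class, at level `(1, 1)`, of the conjugate of
`φ` along the chosen degree-one Frobenius-type arrows `A → A^{(1)}`, `B → B^{(1)}`.
[cite: MochizukiFrdI2008, Def. 3.1 (iii) p.57] -/
@[reducible] noncomputable def toPfRep {A B : C} (φ : A ⟶ B) : Rep (root hF A 1) (root hF B 1) :=
  ⟨⟨1, 1, rfl⟩, conjFr hF φ (isFrobeniusType_frob hF A 1) (isFrobeniusType_frob hF B 1)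
    ((degFr_frob hF A 1).trans (degFr_frob hF B 1).symm)⟩

/-- The defining square of `toPfRep`: `frob_A ≫ φ̃ = φ ≫ frob_B`. [cite: MochizukiFrdI2008, Def. 3.1 (iii) p.57] -/
theorem frob_toPfRep {A B : C} (φ : A ⟶ B) :
    frob hF A 1 ≫ (toPfRep hF φ).hom = φ ≫ frob hF B 1 :=
  conjFr_spec hF φ (isFrobeniusType_frob hF A 1) (isFrobeniusType_frob hF B 1)
    ((degFr_frob hF A 1).trans (degFr_frob hF B 1).symm)

variable (hF) in
/-- "We obtain a natural functor `C → C^pf` [by mapping '`A ↦ (A, 1)`']" (Def. 3.1 (iii), p. 57).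
[cite: MochizukiFrdI2008, Def. 3.1 (iii) p.57] -/
@[reducible] noncomputable def toPf : C ⥤ Perfection hF where
  obj A := root hF A 1
  map φ := Hom.mk (toPfRep hF φ)
  map_id A := by
    change Hom.mk (toPfRep hF (𝟙 A)) = Hom.mk (Rep.id (root hF A 1))
    unfold toPfRep Rep.id
    congr 2
    exact conjFr_id _ _
  map_comp {A B E} φ ψ := by
    change Hom.mk (toPfRep hF (φ ≫ ψ)) = Hom.comp (Hom.mk (toPfRep hF φ)) (Hom.mk (toPfRep hF ψ))
    let T : Level₃ (root hF A 1) (root hF B 1) (root hF E 1) := ⟨1, 1, 1, rfl, rfl⟩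
    rw [Hom.mk_comp_mk, ← mk_compAt T (toPfRep hF φ) (toPfRep hF ψ) (Level.le_rfl _) (Level.le_rfl _)]
    unfold compAt toPfRep
    congr 2
    rw [Level.lift_rfl, Level.lift_rfl]
    exact conjFr_comp φ ψ (isFrobeniusType_frob hF A 1) (isFrobeniusType_frob hF B 1)
      (isFrobeniusType_frob hF E 1) ((degFr_frob hF A 1).trans (degFr_frob hF B 1).symm)
      ((degFr_frob hF B 1).trans (degFr_frob hF E 1).symm)

/-- `toPf A = (A, 1) = root A 1`. [cite: MochizukiFrdI2008, Def. 3.1 (iii) p.57] -/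
theorem root_one (A : C) : root hF A 1 = (toPf hF).obj A := rfl

end Perfection

end PreFrobenioid

end Literature.AlgebraicGeometry.Frobenioids
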